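import Summits.QuantumFields.YangMills.Theorems.BalabanUVNodesN07W23OfRecordRealSlice
import Summits.QuantumFields.YangMills.Theorems.BalabanUVNodesK0Stub1V0Reality
import HarnessLib

/-!
# NODE N07 — THE WHOLE `W`-LETTER OF def-Y's SCHEME OF RECORD MAPS THE REAL SLICE TO HERMITIAN CURRENTS: `V₀` of (26) is REAL on Hermitian configurations over
# the `SU(N)` background, hence its (63)-current `curV0` and the composed V₀-group `curV0full` of (90)–(96) are Hermitian on the real slice; with `W₁` ((85): `HD₃`'s derivative
# real, `J(U₀)` Hermitian) and ✓`W2OfRecord_herm`∕✓`W3OfRecord_herm`, ★★★ `WOfRecordAt_herm` — the REALITY HALF of the «`W` maps real to real» ROW of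
# ✓`Node00.BgSchemeChartLie.sol_mem_of_rows`, at every `N` ([15] (26)–(28) p. 282, (63) p. 287, (80)–(96) pp. 290–292; [B9] p. 391–392)

Cell `pub-ymgap`, width seat `pub-ymgap-dag-n07-w3` (g26), CLAIM-12.  `--kind proof --supports stmt-QuantumFields-27238 --as helper`; count-neutral.
[15] = [Balaban1985Variational]; [B9] = [Balaban1985BackgroundPropagators].

CONTENTS (`σ` = bondwise conjugation; «Hermitian» = `σ`-fixed).
* §1 `conj_deriv_of_real` (a holomorphic germ real on the real axis has real derivative — ✓`fixed_of_hasDerivAt`).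
* §2 (record) `herm_of_pair27_real` (a current pairing really against Hermitian bond functions is Hermitian), `conj_V0OfRecord` (BY NAME from the K0 lineage's
  ✓`K0Stub1V0Reality.conj_V0`: `V₀` of (26) is real for Hermitian `A` over a unitary background), ★★`curV0OfRecord_herm` (the (63)-current `curV0` of `V₀` at the record's
  background is Hermitian at Hermitian jets — via lit ✓`bondPair_curV0`).
* §3 `conjJet_fderiv_of_hermPreserving` (generic: a map of the space (115) differentiable at a Hermitian `A′` and Hermitian-valued on the real slice near it has a real
  derivative there), `conjJet_fderiv_T47OfRecord_eq`, `conjJet_fderiv_E3OfRecord_eq`.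
* §4 `JOfRecordAtBg_herm`, ★★`W1OfRecord_herm` ((85)), ★★`curV0fullOfRecord_herm` ((90)–(96)), ★★★`WOfRecordAt_herm`: for Hermitian `A′` with `‖A′‖ < a_C`
  (guard; Sect. C `Regime`, `Prop4Hyp`, `hCreal` displayed; real `G′`), `(W A′)ᴴ = W A′` for def-Y's `W := WOfRecordAt levB a hpos♭ hQ ε_C G′`.

HONEST LABELS.  `*`-algebra (the `V₀` reality is the K0 lineage's theorem, cited), the (63) certificates and the fixed-point∕closedness facts already in the tree; no estimate.  This is the REALITY half of the `W`-row
only: the TRACELESS half (needed for `TY = evHerm0`) is an `N = 2` matter not touched here; the `𝒢`-row and `𝔄`-row need it too.  Count-neutral; N07 NOT discharged; P0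
⟨26900⟩ OPEN; R4 is the conditional finite-𝕋⁴ rung only.  Nothing here is a claim about the Yang–Mills mass gap (`Summit.QuantumFields`): finite torus, fixed `ε`;
nothing continuum ∕ OS ∕ Clay.
-/

set_option autoImplicit false

noncomputable section

open scoped Matrix Matrix.Norms.L2Operator InnerProductSpace ComplexConjugate BigOperators Topology

namespace Summit.QuantumFields.YangMills.Theorems.N07WOfRecordRealSlice

open Filter Metric Complex
open NormedSpace (exp)
open Literature.MathematicalPhysics.QuantumFieldTheory.Balaban1983to89
open Literature.MathematicalPhysics.QuantumFieldTheory.Balaban1983to89.T4Continuum (T4Family)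
open T4Continuum BlockAveraging
open B11Eq26ActionExpansion (V0)
open B9SectCLatticeCarrier (Bond)
open B4Sect5Torus (TSite)
open B11Eq111FrakG (nabla115)
open B11Eq115Space (NegSize NegSup levWeight JetSup)
open B11Eq103H1Complex (SiteL2K)
open B11Eq90V0primeCurrent (Tsh Ucur curL curL_apply flat115 flat115_apply)
open B11Eq90Transpose (pair27 pair27_def pair27_eq_sum pair27_add_right pair27_smul_right transCur)
open B11Eq63V0GroupCurrent (curV0 bondPair_curV0)
open B11Eq90V0GroupComposed (T47 curV0full curV0full_apply differentiableOn_T47 differentiable_V0)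
open B11Eq80Current (Emap E3 W1 W2 W3 W80 analyticOnNhd_E3)
open B11Eq174Chart (Regime)
open B11Prop6Scheme (Prop4Hyp)
open Node00
open Summit.QuantumFields.YangMills.Theorems.N07Delta2OfRecordReal (flat115_conj)
open Summit.QuantumFields.YangMills.Theorems.N07QuadPartReality (fixed_of_hasDerivAt conjJet_add conjJet_sub conjJet_smul conjJet_conjJet hasDerivAt_realLine)
open Summit.QuantumFields.YangMills.Theorems.N07EmapOfRecordRealSlice (continuous_conjJet conjJet_T47OfRecord_eq conjJet_E3OfRecord_eq)
open Summit.QuantumFields.YangMills.Theorems.N07W23OfRecordRealSlice (pair27_conj_left eq_of_forall_pair27_eq conjJet_map_of_hermPreserving transCur_herm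
  W2OfRecord_herm W3OfRecord_herm)

/-! ## §1  A holomorphic germ real on the real axis has a real derivative -/

/-- **A function of one complex variable, differentiable at `0` and REAL on the real axis, has a real derivative at `0`** (difference quotients along real `h`).
[folklore] [cite: Balaban1985Variational, (63) p.287 (where it is used)] -/
theorem conj_deriv_of_real {g : ℂ → ℂ} (hg : DifferentiableAt ℂ g 0) (hr : ∀ t : ℝ, conj (g t) = g t) : conj (deriv g 0) = deriv g 0 := by
  have h0 : HasDerivAt g (deriv g 0) (((0 : ℝ) : ℂ)) := by rw [Complex.ofReal_zero]; exact hg.hasDerivAt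
  have hd : HasDerivAt (fun s : ℝ => g s) (deriv g 0) 0 := h0.comp_ofReal
  refine fixed_of_hasDerivAt (σ := fun z : ℂ => conj z) Complex.continuous_conj (fun r a b => ?_) (Eventually.of_forall fun s => hr s) hd
  rw [Complex.real_smul, Complex.real_smul, map_mul, map_sub, Complex.conj_ofReal]

/-! ## §2  At the record: the (63)-current of `V₀` is Hermitian at Hermitian jets -/

section Record

variable (F : T4Family) (N : ℕ) (K : ℕ) (k : ℕ) (Ω : ℕ → Set (Site (F.P K) 0)) (U₀ : GaugeField (F.P K) 0 (SU N))
  [Fact (0 < (F.L : ℝ))] [Fact (0 < (F.P K).eta k)]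

omit [Fact (0 < (F.L : ℝ))] in
/-- **A CURRENT PAIRING REALLY AGAINST EVERY HERMITIAN BOND FUNCTION IS HERMITIAN** (`δ = δ₁ + iδ₂` with `δ₁, δ₂` Hermitian; §1 of ✓`…N07W23OfRecordRealSlice`, lit ✓`pair27_smul_right`).
[cite: Balaban1985Variational, (27) p.282; Balaban1985BackgroundPropagators, p.391] -/
theorem herm_of_pair27_real {Kc : NegSizeLit F N K k Ω 3}
    (h : ∀ δ : Bond (F.P K).d (fun _ => (F.P K).sitesPerDir 0) → Matrix (Fin N) (Fin N) ℂ, star δ = δ →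
      conj (pair27 (tauRecCLM N) Kc δ) = pair27 (tauRecCLM N) Kc δ) :
    ((NegSup.equiv _ _).symm (star (NegSup.equiv (levWeight (F.L : ℝ) ((F.P K).eta k) (bondLevLit F Ω k) 3) (Matrix (Fin N) (Fin N) ℂ) Kc)) :
      NegSizeLit F N K k Ω 3) = Kc := by
  refine eq_of_forall_pair27_eq F N K k Ω fun δ => ?_
  -- `δ = δ₁ + iδ₂`, `δ* = δ₁ + (−i)δ₂`
  set δ₁ : Bond (F.P K).d (fun _ => (F.P K).sitesPerDir 0) → Matrix (Fin N) (Fin N) ℂ := (2 : ℂ)⁻¹ • (δ + star δ) with hδ₁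
  set δ₂ : Bond (F.P K).d (fun _ => (F.P K).sitesPerDir 0) → Matrix (Fin N) (Fin N) ℂ := (2 * I)⁻¹ • (δ - star δ) with hδ₂
  have h2 : star ((2 : ℂ)⁻¹) = (2 : ℂ)⁻¹ := by rw [Complex.star_def, map_inv₀, map_ofNat]
  have h2I : star ((2 * I)⁻¹ : ℂ) = -(2 * I)⁻¹ := by rw [Complex.star_def, map_inv₀, map_mul, map_ofNat, Complex.conj_I, mul_neg, inv_neg]
  have hI : I * (2 * I)⁻¹ = (2 : ℂ)⁻¹ := by rw [mul_inv, mul_comm (2 : ℂ)⁻¹, ← mul_assoc, mul_inv_cancel₀ I_ne_zero, one_mul]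
  have h₁ : star δ₁ = δ₁ := by rw [hδ₁, star_smul, h2, star_add, star_star, add_comm]
  have h₂ : star δ₂ = δ₂ := by rw [hδ₂, star_smul, h2I, star_sub, star_star, neg_smul, ← smul_neg, neg_sub]
  have hδ : δ = δ₁ + I • δ₂ := by rw [hδ₁, hδ₂, smul_smul, hI]; module
  have hδ' : star δ = δ₁ + (-I) • δ₂ := by rw [hδ₁, hδ₂, smul_smul, neg_mul, hI]; module
  clear_value δ₁ δ₂
  rw [pair27_conj_left, hδ', hδ, pair27_add_right, pair27_add_right, pair27_smul_right, pair27_smul_right, map_add, map_mul, h δ₁ h₁, h δ₂ h₂, map_neg,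
    Complex.conj_I, neg_neg]

omit [Fact (0 < (F.L : ℝ))] [Fact (0 < (F.P K).eta k)] in
/-- **`V₀` AT THE RECORD'S BACKGROUND IS REAL ON HERMITIAN BOND FUNCTIONS** (✓`K0Stub1V0Reality.conj_V0` with `U₀(b)⁻¹ = U₀(b)*`
✓`ucur_unitsOfRecord_inv_eq_star`, `τ = tr`). [cite: Balaban1985Variational, (26)–(28) p.282] -/
theorem conj_V0OfRecord {x : Bond (F.P K).d (fun _ => (F.P K).sitesPerDir 0) → Matrix (Fin N) (Fin N) ℂ} (hx : star x = x) :
    conj (V0 Tsh (Ucur (unitsOfRecord F N U₀)) ((F.P K).eta k) (F.P K).d (tauRecCLM N : Matrix (Fin N) (Fin N) ℂ →ₗ[ℂ] ℂ) (curL x)) =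
      V0 Tsh (Ucur (unitsOfRecord F N U₀)) ((F.P K).eta k) (F.P K).d (tauRecCLM N : Matrix (Fin N) (Fin N) ℂ →ₗ[ℂ] ℂ) (curL x) := by
  refine K0Stub1V0Reality.conj_V0 Tsh (Ucur (unitsOfRecord F N U₀)) (ucur_unitsOfRecord_inv_eq_star (F := F) (N := N) (U₀ := U₀)) _ (fun a b => ?_)
    (fun a => ?_) ((F.P K).eta k) (F.P K).d (fun μ y => ?_)
  · rw [ContinuousLinearMap.coe_coe, tauRecCLM_mul_comm]
  · rw [ContinuousLinearMap.coe_coe, tauRecCLM_apply, tauRecCLM_apply, Matrix.star_eq_conjTranspose, Matrix.trace_conjTranspose, Complex.star_def]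
  · rw [curL_apply, ← Pi.star_apply (x := x), hx]

/-- ★★ **THE (63)-CURRENT OF `V₀` AT THE RECORD IS HERMITIAN AT HERMITIAN JETS**: for `X` of the space (115) with `Xᴴ = X`, `(curV0 ρ tr U₀ X)ᴴ = curV0 ρ tr U₀ X` — by lit's certificate
✓`bondPair_curV0` (`⟨curV0 X, δ⟩ = (d/dt)V₀(X + tδ)|₀`), `V₀` real along the real line `X + tδ` (`δ` Hermitian) and §2. [cite: Balaban1985Variational, (63) p.287, (90) p.291] -/
theorem curV0OfRecord_herm {X : Space115Lit F N K k Ω U₀}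
    (hX : ((JetSup.equiv _ _ (nabla115 ((F.P K).eta k) (unitsOfRecord F N U₀))).symm
      (star (JetSup.equiv _ _ (nabla115 ((F.P K).eta k) (unitsOfRecord F N U₀)) X)) : Space115Lit F N K k Ω U₀) = X) :
    ((NegSup.equiv _ _).symm (star (NegSup.equiv (levWeight (F.L : ℝ) ((F.P K).eta k) (bondLevLit F Ω k) 3) (Matrix (Fin N) (Fin N) ℂ)
        (curV0 (rhoRec N) (tauRecCLM N) (unitsOfRecord F N U₀) X))) : NegSizeLit F N K k Ω 3) =
      curV0 (rhoRec N) (tauRecCLM N) (unitsOfRecord F N U₀) X := by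
  have hd : 4 ≤ (F.P K).d := by rw [T4Family.P_d]
  have hρ := tauRecCLM_rhoRec_mul N
  have hτ := tauRecCLM_mul_comm N
  -- `X` read as a Hermitian bond function
  have hXf : star (flat115 X) = flat115 X := by
    have h := congrArg flat115 hX
    rwa [flat115_conj] at h
  refine herm_of_pair27_real F N K k Ω fun δ hδ => ?_
  rw [pair27_def, bondPair_curV0 (rhoRec N) (tauRecCLM N) hρ hτ hd (unitsOfRecord F N U₀) X δ]
  refine conj_deriv_of_real ?_ fun t => ?_
  · refine ((differentiable_V0 (tauRecCLM N) hτ hd (unitsOfRecord F N U₀)).comp ?_).differentiableAt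
    exact (differentiable_const _).add (differentiable_id.smul_const _)
  · have hline : curL (JetSup.equiv (levWeight (F.L : ℝ) ((F.P K).eta k) (bondLevLit F Ω k) 1) (levWeight (F.L : ℝ) ((F.P K).eta k) (pairLevLit F Ω k) 2)
          (nabla115 ((F.P K).eta k) (unitsOfRecord F N U₀)) X) + ((t : ℝ) : ℂ) • curL δ =
        curL (flat115 X + ((t : ℝ) : ℂ) • δ) := by
      rw [map_add, map_smul, flat115_apply]
    have hxt : star (flat115 X + ((t : ℝ) : ℂ) • δ) = flat115 X + ((t : ℝ) : ℂ) • δ := by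
      rw [star_add, star_smul, hXf, hδ, Complex.star_def, Complex.conj_ofReal]
    rw [hline]
    exact conj_V0OfRecord F N K k U₀ hxt

end Record

/-! ## §3  Derivatives of Hermitian-valued maps of the space (115) are real -/

section Deriv

variable (F : T4Family) (N : ℕ) (K : ℕ) (k : ℕ) (Ω : ℕ → Set (Site (F.P K) 0)) (U₀ : GaugeField (F.P K) 0 (SU N))
  [Fact (0 < (F.L : ℝ))] [Fact (0 < (F.P K).eta k)]

/-- **GENERIC: THE DERIVATIVE OF A MAP OF THE SPACE (115), DIFFERENTIABLE AT A HERMITIAN `A′` WITH `‖A′‖ < a_C` AND HERMITIAN-VALUED ON THE HERMITIAN `a_C`-BALL, MAPS HERMITIAN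
DIRECTIONS TO HERMITIAN JETS** (✓`fixed_of_hasDerivAt` on the real curve `t ↦ f(A′ + tY)`). [cite: Balaban1985Variational, (85)–(90) p.291 (where it is used)] -/
theorem conjJet_fderiv_of_hermPreserving {f : Space115Lit F N K k Ω U₀ → Space115Lit F N K k Ω U₀} {aC : ℝ} {A' Y : Space115Lit F N K k Ω U₀}
    (hf : DifferentiableAt ℂ f A')
    (hpres : ∀ B : Space115Lit F N K k Ω U₀,
      ((JetSup.equiv _ _ (nabla115 ((F.P K).eta k) (unitsOfRecord F N U₀))).symm
        (star (JetSup.equiv _ _ (nabla115 ((F.P K).eta k) (unitsOfRecord F N U₀)) B)) : Space115Lit F N K k Ω U₀) = B → ‖B‖ < aC →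
      ((JetSup.equiv _ _ (nabla115 ((F.P K).eta k) (unitsOfRecord F N U₀))).symm
        (star (JetSup.equiv _ _ (nabla115 ((F.P K).eta k) (unitsOfRecord F N U₀)) (f B))) : Space115Lit F N K k Ω U₀) = f B)
    (hA' : ((JetSup.equiv _ _ (nabla115 ((F.P K).eta k) (unitsOfRecord F N U₀))).symm
      (star (JetSup.equiv _ _ (nabla115 ((F.P K).eta k) (unitsOfRecord F N U₀)) A')) : Space115Lit F N K k Ω U₀) = A') (hn : ‖A'‖ < aC)
    (hY : ((JetSup.equiv _ _ (nabla115 ((F.P K).eta k) (unitsOfRecord F N U₀))).symm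
      (star (JetSup.equiv _ _ (nabla115 ((F.P K).eta k) (unitsOfRecord F N U₀)) Y)) : Space115Lit F N K k Ω U₀) = Y) :
    ((JetSup.equiv _ _ (nabla115 ((F.P K).eta k) (unitsOfRecord F N U₀))).symm
        (star (JetSup.equiv _ _ (nabla115 ((F.P K).eta k) (unitsOfRecord F N U₀)) (fderiv ℂ f A' Y))) : Space115Lit F N K k Ω U₀) = fderiv ℂ f A' Y := by
  have hτc := continuous_conjJet F N K k Ω U₀
  have hτlin : ∀ (r : ℝ) (u v : Space115Lit F N K k Ω U₀),
      ((JetSup.equiv _ _ (nabla115 ((F.P K).eta k) (unitsOfRecord F N U₀))).symm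
          (star (JetSup.equiv _ _ (nabla115 ((F.P K).eta k) (unitsOfRecord F N U₀)) (r • (u - v)))) : Space115Lit F N K k Ω U₀) =
        r • (((JetSup.equiv _ _ (nabla115 ((F.P K).eta k) (unitsOfRecord F N U₀))).symm
            (star (JetSup.equiv _ _ (nabla115 ((F.P K).eta k) (unitsOfRecord F N U₀)) u)) : Space115Lit F N K k Ω U₀) -
          (JetSup.equiv _ _ (nabla115 ((F.P K).eta k) (unitsOfRecord F N U₀))).symm
            (star (JetSup.equiv _ _ (nabla115 ((F.P K).eta k) (unitsOfRecord F N U₀)) v))) := fun r u v => by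
    rw [← Complex.coe_smul, ← Complex.coe_smul, conjJet_smul, Complex.conj_ofReal, conjJet_sub]
  have hd : HasFDerivAt f (fderiv ℂ f A') A' := hf.hasFDerivAt
  -- the real curve `t ↦ f(A′ + tY)` and its derivative at `0`
  have hcurve : HasDerivAt (fun t : ℝ => f (A' + ((t : ℂ)) • Y)) (fderiv ℂ f A' Y) 0 := by
    have hγ : HasDerivAt (fun t : ℝ => A' + ((t : ℂ)) • Y) Y 0 := (hasDerivAt_realLine F N K k Ω U₀ Y 0).const_add A'
    have hd0 : HasFDerivAt f (fderiv ℂ f A') (A' + (((0 : ℝ) : ℂ)) • Y) := by rwa [Complex.ofReal_zero, zero_smul, add_zero]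
    have hc := (hd0.restrictScalars ℝ).comp_hasDerivAt (0 : ℝ) hγ
    simpa only [Function.comp_def, ContinuousLinearMap.coe_restrictScalars'] using hc
  -- the curve is Hermitian-valued near `0`
  have hball : ∀ᶠ t : ℝ in 𝓝 0, ‖A' + ((t : ℂ)) • Y‖ < aC := by
    have hc : Continuous fun t : ℝ => ‖A' + ((t : ℂ)) • Y‖ := (continuous_const.add (Complex.continuous_ofReal.smul continuous_const)).norm
    have h0 : ‖A' + (((0 : ℝ) : ℂ)) • Y‖ < aC := by rwa [Complex.ofReal_zero, zero_smul, add_zero]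
    exact hc.continuousAt.eventually (Iio_mem_nhds h0)
  have hreal : ∀ᶠ t : ℝ in 𝓝 0, ((JetSup.equiv _ _ (nabla115 ((F.P K).eta k) (unitsOfRecord F N U₀))).symm
      (star (JetSup.equiv _ _ (nabla115 ((F.P K).eta k) (unitsOfRecord F N U₀)) (f (A' + ((t : ℂ)) • Y)))) : Space115Lit F N K k Ω U₀) =
      f (A' + ((t : ℂ)) • Y) := by
    filter_upwards [hball] with t ht
    have hAt : ((JetSup.equiv _ _ (nabla115 ((F.P K).eta k) (unitsOfRecord F N U₀))).symm
        (star (JetSup.equiv _ _ (nabla115 ((F.P K).eta k) (unitsOfRecord F N U₀)) (A' + ((t : ℂ)) • Y))) : Space115Lit F N K k Ω U₀) =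
        A' + ((t : ℂ)) • Y := by
      rw [conjJet_add, conjJet_smul, Complex.conj_ofReal, hA', hY]
    exact hpres _ hAt ht
  exact fixed_of_hasDerivAt hτc hτlin hreal hcurve

variable [NeZero N] [Fact (0 < c0Rec F K k)] [Fact (∀ c, 0 < wBRec F K k c)] {a : ℝ}
  (hposb : ∀ x, x ≠ 0 → 0 < RCLike.re ⟪x, laplaceAOfRecord F N k U₀ (QOfRecord F N k U₀) (QflatOfRecord F N k) a x⟫_ℂ)
  (hQ : Function.Surjective (QOfRecord F N k U₀)) (levB : PBond (F.P K) k → ℕ) {b C₂ c₄ aC εC : ℝ}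
  {Gp : SiteL2K ℂ (F.P K).d (fun _ => (F.P K).sitesPerDir 0) (c0Rec F K k) (WRec N) →ₗ[ℂ]
    SiteL2K ℂ (F.P K).d (fun _ => (F.P K).sitesPerDir 0) (c0Rec F K k) (WRec N)}
  (RC : Regime (H1OfRecordAtBgFlat F N K k Ω U₀ levB a hposb hQ) 0 (CslOfRecord F N K k Ω U₀ levB) b 0 C₂ c₄ 0 aC εC)
  (hCreal : ∀ A : Space115Lit F N K k Ω U₀,
    ((JetSup.equiv _ _ (nabla115 ((F.P K).eta k) (unitsOfRecord F N U₀))).symm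
        (star (JetSup.equiv _ _ (nabla115 ((F.P K).eta k) (unitsOfRecord F N U₀)) A)) : Space115Lit F N K k Ω U₀) = A →
    ‖A‖ ≤ εC + aC → ((NegSup.equiv _ _).symm (star (NegSup.equiv _ _ (CslOfRecord F N K k Ω U₀ levB A))) :
      NegSize (F.L : ℝ) ((F.P K).eta k) levB 0 (Matrix (Fin N) (Fin N) ℂ)) = CslOfRecord F N K k Ω U₀ levB A)

include RC hCreal in
/-- **`D T(A′)` (the derivative of (47)) maps Hermitian directions to Hermitian jets** at Hermitian `A′`, `‖A′‖ < a_C` (lit ✓`differentiableOn_T47`, ✓`conjJet_T47OfRecord_eq`).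
[cite: Balaban1985Variational, (47) p.285, (90) p.291] -/
theorem conjJet_fderiv_T47OfRecord_eq (h : SmallBelow (avOfRecord F N K) k U₀) (hP : Prop4Hyp (CslOfRecord F N K k Ω U₀ levB) C₂ c₄)
    {A' Y : Space115Lit F N K k Ω U₀}
    (hA' : ((JetSup.equiv _ _ (nabla115 ((F.P K).eta k) (unitsOfRecord F N U₀))).symm
      (star (JetSup.equiv _ _ (nabla115 ((F.P K).eta k) (unitsOfRecord F N U₀)) A')) : Space115Lit F N K k Ω U₀) = A') (hn : ‖A'‖ < aC)
    (hY : ((JetSup.equiv _ _ (nabla115 ((F.P K).eta k) (unitsOfRecord F N U₀))).symm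
      (star (JetSup.equiv _ _ (nabla115 ((F.P K).eta k) (unitsOfRecord F N U₀)) Y)) : Space115Lit F N K k Ω U₀) = Y) :
    ((JetSup.equiv _ _ (nabla115 ((F.P K).eta k) (unitsOfRecord F N U₀))).symm
        (star (JetSup.equiv _ _ (nabla115 ((F.P K).eta k) (unitsOfRecord F N U₀))
          (fderiv ℂ (T47 (H1OfRecordAtBgFlat F N K k Ω U₀ levB a hposb hQ) (CslOfRecord F N K k Ω U₀ levB) εC) A' Y))) : Space115Lit F N K k Ω U₀) =
      fderiv ℂ (T47 (H1OfRecordAtBgFlat F N K k Ω U₀ levB a hposb hQ) (CslOfRecord F N K k Ω U₀ levB) εC) A' Y := by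
  have hA'mem : A' ∈ ball (0 : Space115Lit F N K k Ω U₀) aC := by rwa [mem_ball, dist_zero_right]
  exact conjJet_fderiv_of_hermPreserving F N K k Ω U₀ ((differentiableOn_T47 RC hP).differentiableAt (isOpen_ball.mem_nhds hA'mem))
    (fun B hB hnB => conjJet_T47OfRecord_eq F N K k Ω U₀ levB hposb hQ RC hCreal h hB hnB) hA' hn hY

include RC hCreal in
/-- **`D(HD₃)(A′)` maps Hermitian directions to Hermitian jets** at Hermitian `A′`, `‖A′‖ < a_C` (lit ✓`analyticOnNhd_E3` under `Prop4Hyp`, ✓`conjJet_E3OfRecord_eq`).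
[cite: Balaban1985Variational, (78) p.290, (85) p.291] -/
theorem conjJet_fderiv_E3OfRecord_eq (h : SmallBelow (avOfRecord F N K) k U₀) (hP : Prop4Hyp (CslOfRecord F N K k Ω U₀ levB) C₂ c₄)
    {A' Y : Space115Lit F N K k Ω U₀}
    (hA' : ((JetSup.equiv _ _ (nabla115 ((F.P K).eta k) (unitsOfRecord F N U₀))).symm
      (star (JetSup.equiv _ _ (nabla115 ((F.P K).eta k) (unitsOfRecord F N U₀)) A')) : Space115Lit F N K k Ω U₀) = A') (hn : ‖A'‖ < aC)
    (hY : ((JetSup.equiv _ _ (nabla115 ((F.P K).eta k) (unitsOfRecord F N U₀))).symm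
      (star (JetSup.equiv _ _ (nabla115 ((F.P K).eta k) (unitsOfRecord F N U₀)) Y)) : Space115Lit F N K k Ω U₀) = Y) :
    ((JetSup.equiv _ _ (nabla115 ((F.P K).eta k) (unitsOfRecord F N U₀))).symm
        (star (JetSup.equiv _ _ (nabla115 ((F.P K).eta k) (unitsOfRecord F N U₀))
          (fderiv ℂ (E3 (H1OfRecordAtBgFlat F N K k Ω U₀ levB a hposb hQ) (CslOfRecord F N K k Ω U₀ levB) εC) A' Y))) : Space115Lit F N K k Ω U₀) =
      fderiv ℂ (E3 (H1OfRecordAtBgFlat F N K k Ω U₀ levB a hposb hQ) (CslOfRecord F N K k Ω U₀ levB) εC) A' Y := by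
  haveI : CompleteSpace (NegSize (F.L : ℝ) ((F.P K).eta k) levB 0 (Matrix (Fin N) (Fin N) ℂ)) := FiniteDimensional.complete ℂ _
  have hA'mem : A' ∈ ball (0 : Space115Lit F N K k Ω U₀) aC := by rwa [mem_ball, dist_zero_right]
  exact conjJet_fderiv_of_hermPreserving F N K k Ω U₀ ((analyticOnNhd_E3 RC hP) A' hA'mem).differentiableAt
    (fun B hB hnB => conjJet_E3OfRecord_eq F N K k Ω U₀ levB hposb hQ RC hCreal h hB hnB) hA' hn hY

/-! ## §4  `W₁`, the V₀-group and the whole `W` at def-Y's letters are Hermitian on the real slice -/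

omit [NeZero N] [Fact (0 < c0Rec F K k)] [Fact (∀ c, 0 < wBRec F K k c)] in
/-- **`J(U₀)` OF RECORD IS HERMITIAN** as a current (✓`star_JOfRecordAtBg_apply`, bondwise). [cite: Balaban1985Variational, (28) p.282] -/
theorem JOfRecordAtBg_herm :
    ((NegSup.equiv _ _).symm (star (NegSup.equiv (levWeight (F.L : ℝ) ((F.P K).eta k) (bondLevLit F Ω k) 3) (Matrix (Fin N) (Fin N) ℂ)
        (JOfRecordAtBg F N K k Ω U₀))) : NegSizeLit F N K k Ω 3) = JOfRecordAtBg F N K k Ω U₀ := by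
  apply (NegSup.equiv (levWeight (F.L : ℝ) ((F.P K).eta k) (bondLevLit F Ω k) 3) (Matrix (Fin N) (Fin N) ℂ)).injective
  rw [Equiv.apply_symm_apply]
  funext bd
  rw [Pi.star_apply, star_JOfRecordAtBg_apply]

include RC hCreal in
/-- ★★ **(85): `W₁(A′) = −𝔇₃*(A′)H*J` IS HERMITIAN** at def-Y's letters for Hermitian `A′`, `‖A′‖ < a_C` (guard; regime ∕ `Prop4Hyp` ∕ `hCreal` displayed).
[cite: Balaban1985Variational, (85) p.291] -/
theorem W1OfRecord_herm (h : SmallBelow (avOfRecord F N K) k U₀) (hP : Prop4Hyp (CslOfRecord F N K k Ω U₀ levB) C₂ c₄) {A' : Space115Lit F N K k Ω U₀}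
    (hA' : ((JetSup.equiv _ _ (nabla115 ((F.P K).eta k) (unitsOfRecord F N U₀))).symm
      (star (JetSup.equiv _ _ (nabla115 ((F.P K).eta k) (unitsOfRecord F N U₀)) A')) : Space115Lit F N K k Ω U₀) = A') (hn : ‖A'‖ < aC) :
    ((NegSup.equiv _ _).symm (star (NegSup.equiv (levWeight (F.L : ℝ) ((F.P K).eta k) (bondLevLit F Ω k) 3) (Matrix (Fin N) (Fin N) ℂ)
        (W1 (rhoRec N) (tauRecCLM N) (H1OfRecordAtBgFlat F N K k Ω U₀ levB a hposb hQ) (CslOfRecord F N K k Ω U₀ levB) εC (JOfRecordAtBg F N K k Ω U₀) A'))) :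
        NegSizeLit F N K k Ω 3) =
      W1 (rhoRec N) (tauRecCLM N) (H1OfRecordAtBgFlat F N K k Ω U₀ levB a hposb hQ) (CslOfRecord F N K k Ω U₀ levB) εC (JOfRecordAtBg F N K k Ω U₀) A' := by
  have hM := conjJet_map_of_hermPreserving F N K k Ω U₀ _ fun Y hY => conjJet_fderiv_E3OfRecord_eq F N K k Ω U₀ hposb hQ levB RC hCreal h hP hA' hn hY
  have h1 := transCur_herm F N K k Ω U₀ _ hM (JOfRecordAtBg_herm F N K k Ω U₀)
  apply (NegSup.equiv (levWeight (F.L : ℝ) ((F.P K).eta k) (bondLevLit F Ω k) 3) (Matrix (Fin N) (Fin N) ℂ)).injective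
  have h1' := congrArg (NegSup.equiv (levWeight (F.L : ℝ) ((F.P K).eta k) (bondLevLit F Ω k) 3) (Matrix (Fin N) (Fin N) ℂ)) h1
  rw [Equiv.apply_symm_apply] at h1' ⊢
  rw [W1, NegSup.equiv_neg, star_neg, h1']

include RC hCreal in
/-- ★★ **THE V₀-GROUP (90)–(96) OF `W`, `curV0full(A′) = (T′(A′))ᵗ curV0(T A′)`, IS HERMITIAN** at def-Y's letters for Hermitian `A′`, `‖A′‖ < a_C` (§3–§4 + ✓`transCur_herm`).
[cite: Balaban1985Variational, (90) p.291, (91)–(96) p.292] -/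
theorem curV0fullOfRecord_herm (h : SmallBelow (avOfRecord F N K) k U₀) (hP : Prop4Hyp (CslOfRecord F N K k Ω U₀ levB) C₂ c₄) {A' : Space115Lit F N K k Ω U₀}
    (hA' : ((JetSup.equiv _ _ (nabla115 ((F.P K).eta k) (unitsOfRecord F N U₀))).symm
      (star (JetSup.equiv _ _ (nabla115 ((F.P K).eta k) (unitsOfRecord F N U₀)) A')) : Space115Lit F N K k Ω U₀) = A') (hn : ‖A'‖ < aC) :
    ((NegSup.equiv _ _).symm (star (NegSup.equiv (levWeight (F.L : ℝ) ((F.P K).eta k) (bondLevLit F Ω k) 3) (Matrix (Fin N) (Fin N) ℂ)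
        (curV0full (rhoRec N) (tauRecCLM N) (unitsOfRecord F N U₀) (H1OfRecordAtBgFlat F N K k Ω U₀ levB a hposb hQ) (CslOfRecord F N K k Ω U₀ levB) εC A'))) :
        NegSizeLit F N K k Ω 3) =
      curV0full (rhoRec N) (tauRecCLM N) (unitsOfRecord F N U₀) (H1OfRecordAtBgFlat F N K k Ω U₀ levB a hposb hQ) (CslOfRecord F N K k Ω U₀ levB) εC A' := by
  have hM := conjJet_map_of_hermPreserving F N K k Ω U₀ _ fun Y hY => conjJet_fderiv_T47OfRecord_eq F N K k Ω U₀ hposb hQ levB RC hCreal h hP hA' hn hY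
  rw [curV0full_apply]
  exact transCur_herm F N K k Ω U₀ _ hM (curV0OfRecord_herm F N K k Ω U₀ (conjJet_T47OfRecord_eq F N K k Ω U₀ levB hposb hQ RC hCreal h hA' hn))

include RC hCreal in
/-- ★★★ **THE `W`-LETTER OF def-Y's SCHEME OF RECORD MAPS THE REAL SLICE TO HERMITIAN CURRENTS**: for Hermitian `A′` with `‖A′‖ < a_C` (guard; Sect. C `Regime`, `Prop4Hyp`,
`hCreal` displayed; real `G′`), `(W A′)ᴴ = W A′` for `W = WOfRecordAt levB a hpos♭ hQ ε_C G′ = W₁ + W₂ + W₃ + curV0full` ((84)–(96)) — the REALITY half of the `W`-row of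
✓`Node00.BgSchemeChartLie.sol_mem_of_rows` (the traceless half is an `N = 2` matter, not here). [cite: Balaban1985Variational, (84) p.290, (85)–(96) pp.291–292] -/
theorem WOfRecordAt_herm (h : SmallBelow (avOfRecord F N K) k U₀) (hP : Prop4Hyp (CslOfRecord F N K k Ω U₀ levB) C₂ c₄)
    (hGp : ∀ s, Gp (B9Eq311TracePairing.starW (phiRec N) s) = B9Eq311TracePairing.starW (phiRec N) (Gp s)) {A' : Space115Lit F N K k Ω U₀}
    (hA' : ((JetSup.equiv _ _ (nabla115 ((F.P K).eta k) (unitsOfRecord F N U₀))).symm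
      (star (JetSup.equiv _ _ (nabla115 ((F.P K).eta k) (unitsOfRecord F N U₀)) A')) : Space115Lit F N K k Ω U₀) = A') (hn : ‖A'‖ < aC) :
    ((NegSup.equiv _ _).symm (star (NegSup.equiv (levWeight (F.L : ℝ) ((F.P K).eta k) (bondLevLit F Ω k) 3) (Matrix (Fin N) (Fin N) ℂ)
        (WOfRecordAt F N K k Ω U₀ levB a hposb hQ εC Gp A'))) : NegSizeLit F N K k Ω 3) = WOfRecordAt F N K k Ω U₀ levB a hposb hQ εC Gp A' := by
  have e := NegSup.equiv (levWeight (F.L : ℝ) ((F.P K).eta k) (bondLevLit F Ω k) 3) (Matrix (Fin N) (Fin N) ℂ)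
  have h1 := congrArg (NegSup.equiv (levWeight (F.L : ℝ) ((F.P K).eta k) (bondLevLit F Ω k) 3) (Matrix (Fin N) (Fin N) ℂ))
    (W1OfRecord_herm F N K k Ω U₀ hposb hQ levB RC hCreal h hP hA' hn)
  have h2 := congrArg (NegSup.equiv (levWeight (F.L : ℝ) ((F.P K).eta k) (bondLevLit F Ω k) 3) (Matrix (Fin N) (Fin N) ℂ))
    (W2OfRecord_herm F N K k Ω U₀ hposb hQ levB RC hCreal h hP hGp hA' hn)
  have h3 := congrArg (NegSup.equiv (levWeight (F.L : ℝ) ((F.P K).eta k) (bondLevLit F Ω k) 3) (Matrix (Fin N) (Fin N) ℂ))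
    (W3OfRecord_herm F N K k Ω U₀ hposb hQ levB RC hCreal h hP hGp hA' hn)
  have h4 := congrArg (NegSup.equiv (levWeight (F.L : ℝ) ((F.P K).eta k) (bondLevLit F Ω k) 3) (Matrix (Fin N) (Fin N) ℂ))
    (curV0fullOfRecord_herm F N K k Ω U₀ hposb hQ levB RC hCreal h hP hA' hn)
  apply (NegSup.equiv (levWeight (F.L : ℝ) ((F.P K).eta k) (bondLevLit F Ω k) 3) (Matrix (Fin N) (Fin N) ℂ)).injective
  rw [Equiv.apply_symm_apply] at h1 h2 h3 h4 ⊢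
  unfold WOfRecordAt W80
  rw [NegSup.equiv_add, NegSup.equiv_add, NegSup.equiv_add, star_add, star_add, star_add, h1, h2, h3, h4]

end Deriv

end Summit.QuantumFields.YangMills.Theorems.N07WOfRecordRealSlice

end
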